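import Summits.NavierStokesRegularity.NavierStokesRegularity.Theorems.SwirlHolderTowerStreamDrift
import HarnessLib

/-!
# SwirlHolderTower, part 4b — the ALGEBRAIC FUNNEL FAMILY: exact polynomial steady passive swirl
# pairs, and an UNCONDITIONAL polynomial-rate ceiling on linear swirl Hölder laws (seat nsreg-p4)

Support file for the DORMANT route `SwirlThreshold` (crux stmt-NavierStokesRegularity-2002) and
planner nsreg-p2's ROUND-15 (`…Theorems.SwirlHolderTower*`).  The ceiling
`linearHolderLaw_ceiling` / `not_linearPolyHolderLaw` (part 2) says that no Hölder law valid for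
the LINEAR class `IsSteadyPassiveSwirl` has a polynomial profile; after part 3c it is conditional
on ONE transcendental input, `FunnelExponent` (the principal eigenvalue `≈ √(N/π)e^{-N/4}` of the
funnel's singular angular problem).  This file proves a WEAKER RATE WITH NO HYPOTHESIS AT ALL, from
an exact algebraic family found by solving the separable swirl equation for the DRIFT instead of
the swirl:

* `exists_odeProfile`: odd polynomials `L_j` (`L_0 = t`,
  `L_{j+1} = t/(2j+3) + (2j+2)/(2j+3)·(1-t²)L_j`; closed form
  `(1-t²)^{j+1/2}∫₀^t(1-s²)^{-j-3/2}ds`) with `(1-t²)L_j' + (2j+1)tL_j = 1`, `0 ≤ L_j ≤ 1` on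
  `[0,1]`;
* with `m = 2j+3`, `g = 2/m`, `c = (m-1)(m+2)/m`, the stream drift (part 4a) with profiles
  `α = -c(1 - (m-1)tL)`, `k = cL` is divergence free, smooth off the origin, of gauge
  `|u| ≤ (m-1)(m+2)(m+1)/(m|x|)` (`family_gauge`, crude), and carries the EXACT separable swirl
  `Θ = |x|^{2/m} sin²ϑ = |x|^{2/m-2} r²` (`family_profile_identity`: the profile identity reduces to
  `gm = 2` and `cg = (2-g)(1+g)`): `isSteadyPassiveSwirl_family`;
* `linearHolderLaw_exponent_le_algebraic`: **every linear Hölder law has `γ(N_j) ≤ 2/(2j+3)` at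
  `N_j = (2j+2)(2j+5)(2j+4)/(2j+3)`** (so `γ(N) ≲ 4/√N` along the family), for all `j : ℕ`;
* `not_linearPolyHolderLaw_of_lt_half`: **for `0 < p < 1/2`, `c > 0`, the law `c(1+N)^{-p}` FAILS
  on the linear class — unconditionally** (kernel-only; no numerics, no ODE fact).

The sharp gauge of the family is `N = c ≈ m` (numerics: `N·g → 2`), which would give `p < 1`; the
exponential rate (every `p`) needs the flat-top funnel eigenfunction, i.e. `FunnelExponent`.
WHAT THIS IS NOT: not NS regularity — explicit steady divergence-free DRIFTS (not Navier–Stokes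
flows) with exact passive swirls, calibrating LINEAR methods from below; `PolyHolderLaw` for NS and
all hard cores untouched; no crux claim.
-/

namespace Summit.NavierStokesRegularity.NavierStokesRegularity.Theorems.SwirlHolderTower

open Set Filter Topology Metric
open scoped Laplacian RealInnerProductSpace
open Literature.Analysis Literature.Analysis.FluidPDE

noncomputable section


/-- **THE ALGEBRAIC ANGULAR PROFILES.**  For every `j : ℕ` there is a polynomial (here: `C^n` for
all `n`, odd) function `L_j` solving the first-order angular equation
`(1 - t²) L' + (2j+1) t L = 1` with `0 ≤ L_j ≤ 1` on `[0,1]`: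
`L_0 = t`, `L_{j+1} = t/(2j+3) + ((2j+2)/(2j+3)) (1-t²) L_j`
(closed form: `L_j(t) = (1-t²)^{j+1/2} ∫₀^t (1-s²)^{-j-3/2} ds`, an odd polynomial of degree
`2j+1`).  These carry the exact separable steady passive swirls `|x|^{2/(2j+3)} sin²ϑ` below. -/
theorem exists_odeProfile (j : ℕ) : ∃ L : ℝ → ℝ, (∀ n : WithTop ℕ∞, ContDiff ℝ n L) ∧
    (∀ t : ℝ, (1 - t ^ 2) * deriv L t + (2 * j + 1) * t * L t = 1) ∧
    (∀ t ∈ Icc (0 : ℝ) 1, 0 ≤ L t ∧ L t ≤ 1) ∧ (∀ t : ℝ, L (-t) = -L t) := by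
  induction j with
  | zero =>
    refine ⟨fun t => t, fun n => contDiff_id, fun t => ?_, fun t ht => ⟨ht.1, ht.2⟩, fun t => rfl⟩
    rw [deriv_id'']
    push_cast
    ring
  | succ j ih =>
    obtain ⟨L, hLs, hode, hbd, hodd⟩ := ih
    have hj : (0 : ℝ) < 2 * j + 3 := by positivity
    refine ⟨fun t => t / (2 * j + 3) + (2 * j + 2) / (2 * j + 3) * ((1 - t ^ 2) * L t),
      fun n => ?_, fun t => ?_, fun t ht => ?_, fun t => ?_⟩
    · exact (contDiff_id.div_const _).add (contDiff_const.mul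
        ((contDiff_const.sub (contDiff_id.pow 2)).mul (hLs n)))
    · have hLd : HasDerivAt L (deriv L t) t :=
        (((hLs 1).differentiable one_ne_zero) t).hasDerivAt
      have h1 : HasDerivAt (fun s : ℝ => 1 - s ^ 2) (-(2 * t)) t := by
        have := (hasDerivAt_pow 2 t).const_sub 1
        simpa using this
      have h : HasDerivAt (fun s : ℝ => s / (2 * j + 3) + (2 * j + 2) / (2 * j + 3) * ((1 - s ^ 2) * L s))
          (1 / (2 * j + 3) + (2 * j + 2) / (2 * j + 3) * (-(2 * t) * L t + (1 - t ^ 2) * deriv L t)) t :=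
        ((hasDerivAt_id t).div_const _).add ((h1.mul hLd).const_mul _)
      rw [h.deriv]
      have hIH := hode t
      push_cast
      field_simp
      linear_combination (2 * j + 2) * (1 - t ^ 2) * hIH
    · obtain ⟨h0, h1⟩ := hbd t ht
      have ht0 := ht.1
      have ht1 := ht.2
      have hsq : 0 ≤ 1 - t ^ 2 := by nlinarith
      have hsq1 : 1 - t ^ 2 ≤ 1 := by nlinarith
      constructor
      · positivity
      · have hprod : (1 - t ^ 2) * L t ≤ 1 := by nlinarith
        calc t / (2 * j + 3) + (2 * j + 2) / (2 * j + 3) * ((1 - t ^ 2) * L t)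
            ≤ 1 / (2 * j + 3) + (2 * j + 2) / (2 * j + 3) * 1 := by gcongr
          _ = 1 := by field_simp; ring
    · simp only [hodd t]
      ring


/-! ### The algebraic funnel family: profiles `α = -c(1 - (m-1) t L)`, `k = c L`, `G = 1 - t²` -/

section Family

variable {L : ℝ → ℝ} {m : ℝ}

/-- `|L| ≤ 1` on `[-1,1]` for an odd profile with `0 ≤ L ≤ 1` on `[0,1]`. -/
theorem abs_profile_le_one (hbd : ∀ t ∈ Icc (0 : ℝ) 1, 0 ≤ L t ∧ L t ≤ 1)
    (hodd : ∀ t : ℝ, L (-t) = -L t) {t : ℝ} (ht : t ∈ Icc (-1 : ℝ) 1) : |L t| ≤ 1 := by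
  rcases le_or_gt 0 t with h | h
  · obtain ⟨h0, h1⟩ := hbd t ⟨h, ht.2⟩
    rw [abs_of_nonneg h0]; exact h1
  · obtain ⟨h0, h1⟩ := hbd (-t) ⟨by linarith, by linarith [ht.1]⟩
    rw [hodd] at h0 h1
    rw [abs_of_nonpos (by linarith)]; linarith

/-- The divergence-free relation `α = t k - (1-t²) k'` for the family (from the angular equation
`(1-t²)L' + (m-2) t L = 1`). -/
theorem family_div_rel (hL : ContDiff ℝ 2 L)
    (hode : ∀ t : ℝ, (1 - t ^ 2) * deriv L t + (m - 2) * t * L t = 1) (t : ℝ) :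
    -((m - 1) * (m + 2) / m * (1 - (m - 1) * t * L t)) =
      t * ((m - 1) * (m + 2) / m * L t) - (1 - t ^ 2) * deriv (fun s => (m - 1) * (m + 2) / m * L s) t := by
  have hLd : DifferentiableAt ℝ L t := ((hL.differentiable (by norm_num)) t)
  rw [deriv_const_mul _ hLd]
  linear_combination ((m - 1) * (m + 2) / m) * hode t

/-- Calculus of `G = 1 - t²`: `G' = -2t`. -/
theorem deriv_one_sub_sq : deriv (fun t : ℝ => 1 - t ^ 2) = fun t => -(2 * t) := by
  funext t
  exact ((hasDerivAt_pow 2 t).const_sub 1).deriv.trans (by norm_num)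

/-- Calculus of `G = 1 - t²`: `G'' = -2`. -/
theorem deriv_deriv_one_sub_sq (t : ℝ) : deriv (deriv (fun t : ℝ => 1 - t ^ 2)) t = -2 := by
  rw [deriv_one_sub_sq]
  exact ((hasDerivAt_id t).const_mul (2 : ℝ)).neg.deriv.trans (by norm_num)

/-- **THE PROFILE IDENTITY for the family**: with `g = 2/m`, `c = (m-1)(m+2)/m`,
`α = -c(1 - (m-1)tL)`, `k = cL`, `G = 1 - t²`:
`g(α + tk)G + (1-t²)kG' = g(g-1)G + (1-t²)G''` (uses only `gm = 2` and `cg = (2-g)(1+g)`). -/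
theorem family_profile_identity (hm : m ≠ 0) (t : ℝ) :
    2 / m * (-((m - 1) * (m + 2) / m * (1 - (m - 1) * t * L t)) + t * ((m - 1) * (m + 2) / m * L t)) *
        (1 - t ^ 2) +
      (1 - t ^ 2) * ((m - 1) * (m + 2) / m * L t) * deriv (fun t : ℝ => 1 - t ^ 2) t =
      2 / m * (2 / m - 1) * (1 - t ^ 2) + (1 - t ^ 2) * deriv (deriv (fun t : ℝ => 1 - t ^ 2)) t := by
  rw [deriv_deriv_one_sub_sq, deriv_one_sub_sq]
  field_simp
  ring

/-- **GAUGE of the family** (crude, quadratic in `m`): `|α(t)| + |k(t)| ≤ (m-1)(m+2)(m+1)/m` on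
`[-1,1]` for `m ≥ 3` (uses `|L| ≤ 1`). -/
theorem family_gauge (hm : 3 ≤ m) (hbd : ∀ t ∈ Icc (0 : ℝ) 1, 0 ≤ L t ∧ L t ≤ 1)
    (hodd : ∀ t : ℝ, L (-t) = -L t) {t : ℝ} (ht : t ∈ Icc (-1 : ℝ) 1) :
    |(-((m - 1) * (m + 2) / m * (1 - (m - 1) * t * L t)))| + |(m - 1) * (m + 2) / m * L t| ≤
      (m - 1) * (m + 2) * (m + 1) / m := by
  have hm0 : 0 < m := by linarith
  have hc : 0 ≤ (m - 1) * (m + 2) / m := div_nonneg (mul_nonneg (by linarith) (by linarith)) hm0.le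
  have hL1 : |L t| ≤ 1 := abs_profile_le_one hbd hodd ht
  have htabs : |t| ≤ 1 := abs_le.2 ⟨ht.1, ht.2⟩
  have htL : |t * L t| ≤ 1 := by
    rw [abs_mul]; nlinarith [abs_nonneg t, abs_nonneg (L t)]
  have h1 : |(-((m - 1) * (m + 2) / m * (1 - (m - 1) * t * L t)))| ≤ (m - 1) * (m + 2) / m * m := by
    rw [abs_neg, abs_mul, abs_of_nonneg hc]
    refine mul_le_mul_of_nonneg_left ?_ hc
    calc |1 - (m - 1) * t * L t| ≤ |(1:ℝ)| + |(m - 1) * t * L t| := abs_sub _ _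
      _ = 1 + (m - 1) * |t * L t| := by
          rw [abs_one, mul_assoc, abs_mul, abs_of_nonneg (by linarith : (0:ℝ) ≤ m - 1)]
      _ ≤ m := by nlinarith [htL]
  have h2 : |(m - 1) * (m + 2) / m * L t| ≤ (m - 1) * (m + 2) / m * 1 := by
    rw [abs_mul, abs_of_nonneg hc]; gcongr
  calc _ ≤ (m - 1) * (m + 2) / m * m + (m - 1) * (m + 2) / m * 1 := add_le_add h1 h2
    _ = (m - 1) * (m + 2) * (m + 1) / m := by field_simp

/-- **THE ALGEBRAIC FUNNEL PAIR IS A STEADY PASSIVE SWIRL PAIR** of gauge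
`N = (m-1)(m+2)(m+1)/m`: drift `u_{α,k}` with `α = -c(1-(m-1)tL)`, `k = cL`, swirl
`Θ = |x|^{2/m}(1 - x₃²/|x|²) = |x|^{2/m - 2} r²`. -/
theorem isSteadyPassiveSwirl_family (hm : 3 ≤ m) (hL : ContDiff ℝ 2 L)
    (hode : ∀ t : ℝ, (1 - t ^ 2) * deriv L t + (m - 2) * t * L t = 1)
    (hbd : ∀ t ∈ Icc (0 : ℝ) 1, 0 ≤ L t ∧ L t ≤ 1) (hodd : ∀ t : ℝ, L (-t) = -L t) :
    IsSteadyPassiveSwirl ((m - 1) * (m + 2) * (m + 1) / m)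
      (fun y : EuclideanSpace ℝ (Fin 3) =>
        ((fun t : ℝ => -((m - 1) * (m + 2) / m * (1 - (m - 1) * t * L t))) (y 2 / ‖y‖) *
            (‖y‖ ^ 2) ^ (-1 : ℝ)) • y +
          ((fun t : ℝ => (m - 1) * (m + 2) / m * L t) (y 2 / ‖y‖) * (‖y‖ ^ 2) ^ (-(1 / 2 : ℝ))) •
            (EuclideanSpace.single 2 1 : EuclideanSpace ℝ (Fin 3)))
      (separableSwirl (2 / m) (fun t => 1 - t ^ 2)) := by
  have hm0 : 0 < m := by linarith
  have hg : 0 < 2 / m := by positivity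
  have hG : ContDiff ℝ 2 (fun t : ℝ => 1 - t ^ 2) := contDiff_const.sub (contDiff_id.pow 2)
  have hα : ContDiff ℝ 1 (fun t : ℝ => -((m - 1) * (m + 2) / m * (1 - (m - 1) * t * L t))) :=
    (contDiff_const.mul (contDiff_const.sub ((contDiff_const.mul contDiff_id).mul
      (hL.of_le one_le_two)))).neg
  have hk : ContDiff ℝ 1 (fun t : ℝ => (m - 1) * (m + 2) / m * L t) :=
    contDiff_const.mul (hL.of_le one_le_two)
  refine ⟨fun x hx => ?_, contDiffOn_streamDrift hα hk, fun x hx => ?_, ?_,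
    contDiffOn_separableSwirl hG _, fun x hx => ?_, fun x hx => ?_⟩
  · refine (norm_streamDrift_le (fun t : ℝ => -((m - 1) * (m + 2) / m * (1 - (m - 1) * t * L t)))
      (fun t : ℝ => (m - 1) * (m + 2) / m * L t) hx).trans ?_
    exact div_le_div_of_nonneg_right (family_gauge hm hbd hodd (div_norm_mem_Icc x)) (norm_nonneg x)
  · exact divergence_streamDrift_eq_zero hα hk (fun t _ => family_div_rel hL hode t) hx
  · refine continuous_separableSwirl_of_abs_le hG hg (M := 1) fun t ht => ?_
    rw [abs_le]; constructor <;> nlinarith [ht.1, ht.2]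
  · exact separableSwirl_eq_zero_of_cylRadius_eq_zero' hg (by norm_num) (by norm_num) hx
  · exact streamDrift_swirl_equation hG (fun t : ℝ => -((m - 1) * (m + 2) / m * (1 - (m - 1) * t * L t)))
      (fun t : ℝ => (m - 1) * (m + 2) / m * L t) (2 / m) (fun t _ => family_profile_identity hm0.ne' t) hx

end Family

/-! ### The unconditional polynomial-rate ceiling -/

/-- The explicit gauge of the `j`-th algebraic funnel pair, `N_j = (m-1)(m+2)(m+1)/m`, `m = 2j+3`. -/
theorem algebraicGauge_pos (j : ℕ) : (0 : ℝ) < (2 * j + 2) * (2 * j + 5) * (2 * j + 4) / (2 * j + 3) := by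
  positivity

/-- **UNCONDITIONAL CEILING, polynomial rate**: every Hölder law valid for steady passive swirl
pairs has `γ(N_j) ≤ 2/(2j+3)` at the gauges `N_j = (2j+2)(2j+5)(2j+4)/(2j+3)` (`≈ 4j²`), for every
`j : ℕ` — no `FunnelExponent`, no numerics: the witnesses are the exact algebraic pairs. -/
theorem linearHolderLaw_exponent_le_algebraic {γ : ℝ → ℝ} (hlaw : LinearHolderLaw γ) (j : ℕ) :
    γ ((2 * j + 2) * (2 * j + 5) * (2 * j + 4) / (2 * j + 3)) ≤ 2 / (2 * j + 3) := by
  obtain ⟨K, hK, hlaw⟩ := hlaw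
  obtain ⟨L, hLs, hode, hbd, hodd⟩ := exists_odeProfile j
  set m : ℝ := 2 * j + 3 with hm
  have hm3 : 3 ≤ m := by rw [hm]; have : (0:ℝ) ≤ j := Nat.cast_nonneg j; linarith
  have hm0 : 0 < m := by linarith
  have hode' : ∀ t : ℝ, (1 - t ^ 2) * deriv L t + (m - 2) * t * L t = 1 := by
    intro t; rw [hm]; have := hode t; linear_combination this
  have hpair := isSteadyPassiveSwirl_family hm3 (hLs 2) hode' hbd hodd
  have hN : (m - 1) * (m + 2) * (m + 1) / m = (2 * j + 2) * (2 * j + 5) * (2 * j + 4) / (2 * j + 3) := by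
    rw [hm]; ring
  have hgm : 2 / m = 2 / (2 * j + 3) := by rw [hm]
  rw [hN, hgm] at hpair
  set N : ℝ := (2 * j + 2) * (2 * j + 5) * (2 * j + 4) / (2 * j + 3) with hNdef
  set g : ℝ := 2 / (2 * j + 3) with hgdef
  have hN0 : 0 ≤ N := (algebraicGauge_pos j).le
  have hg0 : 0 < g := by positivity
  -- values of Θ = |x|^g (1 - t²) on the closed unit ball lie in [0, 1]
  have hconf : ∀ x ∈ closedBall (0 : EuclideanSpace ℝ (Fin 3)) 1,
      separableSwirl g (fun t => 1 - t ^ 2) x ∈ Icc (0 : ℝ) 1 := by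
    intro x hx
    have hx1 : ‖x‖ ≤ 1 := by simpa using hx
    have ht := div_norm_mem_Icc x
    have hG0 : 0 ≤ 1 - (x 2 / ‖x‖) ^ 2 := by nlinarith [ht.1, ht.2]
    have hG1 : 1 - (x 2 / ‖x‖) ^ 2 ≤ 1 := by nlinarith
    have hρ0 : 0 ≤ ‖x‖ ^ g := Real.rpow_nonneg (norm_nonneg x) g
    have hρ1 : ‖x‖ ^ g ≤ 1 := Real.rpow_le_one (norm_nonneg x) hx1 hg0.le
    refine ⟨mul_nonneg hρ0 hG0, ?_⟩
    calc ‖x‖ ^ g * (1 - (x 2 / ‖x‖) ^ 2) ≤ 1 * 1 := by gcongr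
      _ = 1 := one_mul 1
  have step : ∀ r : ℝ, 0 < r → r ≤ 1 → r ^ g ≤ K * (1 + N) ^ K * r ^ (γ N) := by
    intro r hr hr1
    obtain ⟨a', c', -, hconf', hlen⟩ := hlaw N hN0 _ _ hpair 0 1 zero_le_one hconf r hr hr1
    have h0mem : separableSwirl g (fun t => 1 - t ^ 2) 0 ∈ Icc a' c' := hconf' 0 (by simp [hr.le])
    rw [separableSwirl_zero hg0] at h0mem
    have ht₀ : (0 : ℝ) ∈ Icc (-1 : ℝ) 1 := by constructor <;> norm_num
    have hPmem : separableSwirl g (fun t => 1 - t ^ 2) (polarPoint r 0) ∈ Icc a' c' := by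
      apply hconf'
      simp [norm_polarPoint hr.le ht₀]
    rw [separableSwirl_polarPoint hr ht₀] at hPmem
    have h1 : r ^ g ≤ c' - a' := by nlinarith [hPmem.2, h0mem.1]
    calc r ^ g ≤ c' - a' := h1
      _ ≤ K * (1 + N) ^ K * r ^ γ N * (1 - 0) := hlen
      _ = K * (1 + N) ^ K * r ^ γ N := by ring
  have hK' : 0 < K * (1 + N) ^ K := by positivity
  exact exponent_le_of_rpow_le hK' step


/-- **NO SLOWLY-DECAYING POLYNOMIAL HÖLDER LAW FOR PASSIVE SWIRLS — UNCONDITIONAL**: for every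
`0 < p < 1/2` and `c > 0` the law with profile `c(1+N)^{-p}` FAILS on the linear class
(`γ(N_j) ≤ 2/(2j+3) ≈ 2/√N_j` along the algebraic family).  The full statement
`not_linearPolyHolderLaw` (every `p > 0`) remains conditional on `FunnelExponent` (part 3c). -/
theorem not_linearPolyHolderLaw_of_lt_half {p c : ℝ} (hp : 0 < p) (hp2 : p < 1 / 2) (hc : 0 < c) :
    ¬ LinearHolderLaw (fun N => c * (1 + N) ^ (-p)) := by
  intro hlaw
  set q : ℝ := 1 - 2 * p with hq
  have hq0 : 0 < q := by rw [hq]; linarith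
  obtain ⟨j, hj⟩ := exists_nat_gt ((4 / c) ^ q⁻¹)
  have hle := linearHolderLaw_exponent_le_algebraic hlaw j
  set N : ℝ := (2 * j + 2) * (2 * j + 5) * (2 * j + 4) / (2 * j + 3) with hN
  set M : ℝ := 2 * j + 5 with hM
  have hj0 : (0 : ℝ) ≤ j := Nat.cast_nonneg j
  have hM5 : 5 ≤ M := by rw [hM]; linarith
  have hM0 : 0 < M := by linarith
  have hN0 : 0 ≤ N := (algebraicGauge_pos j).le
  -- `1 + N ≤ M²`
  have hN1 : 1 + N ≤ M ^ 2 := by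
    have key : (2 * (j:ℝ) + 2) * (2 * j + 5) * (2 * j + 4) / (2 * j + 3) ≤ (2 * j + 4) * (2 * j + 5) := by
      rw [div_le_iff₀ (by linarith)]
      nlinarith
    rw [hN, hM]
    nlinarith
  -- `(1+N)^{-p} ≥ (M²)^{-p} = M^q / M`
  have h1 : (M ^ 2) ^ (-p) ≤ (1 + N) ^ (-p) :=
    Real.rpow_le_rpow_of_nonpos (by linarith) hN1 (by linarith)
  have h2 : (M ^ 2) ^ (-p) = M ^ q / M := by
    rw [← Real.rpow_natCast M 2, ← Real.rpow_mul hM0.le, ← Real.rpow_sub_one hM0.ne']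
    congr 1; rw [hq]; push_cast; ring
  have h3 : c * (M ^ q / M) ≤ 2 / (M - 2) := by
    have hj3 : (2 * (j:ℝ) + 3) = M - 2 := by rw [hM]; ring
    rw [← h2, ← hj3]
    exact (mul_le_mul_of_nonneg_left h1 hc.le).trans hle
  rw [mul_div_assoc', div_le_div_iff₀ hM0 (by linarith)] at h3
  -- `h3 : c * M ^ q * (M - 2) ≤ 2 * M`; since `M - 2 ≥ M/2`, `c M^q ≤ 4`
  have hMq : 0 ≤ M ^ q := Real.rpow_nonneg hM0.le q
  have h4 : c * M ^ q * (M / 2) ≤ c * M ^ q * (M - 2) := by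
    have : M / 2 ≤ M - 2 := by linarith
    exact mul_le_mul_of_nonneg_left this (by positivity)
  have h5 : M ^ q ≤ 4 / c := by
    rw [le_div_iff₀ hc]
    nlinarith
  -- but `M > j > (4/c)^{1/q}`, so `M^q > 4/c`
  have h6 : (4 / c) ^ q⁻¹ < M := by
    have : (j : ℝ) < M := by rw [hM]; linarith
    linarith
  have h7 : 4 / c < M ^ q := by
    have := Real.rpow_lt_rpow (Real.rpow_nonneg (by positivity) _) h6 hq0
    rwa [Real.rpow_inv_rpow (by positivity) hq0.ne'] at this
  linarith

end

end Summit.NavierStokesRegularity.NavierStokesRegularity.Theorems.SwirlHolderTower
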